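import Literature.AlgebraicGeometry.Motives.WeilFormAimingArithmetic
import Literature.AlgebraicGeometry.Motives.WeilOperatorModule
import Mathlib.Algebra.Polynomial.SpecificDegree
import Mathlib.RingTheory.AdjoinRoot
import Mathlib.LinearAlgebra.Matrix.BilinearForm
import HarnessLib

/-!
# Isotropic coefficient vectors for the block Gram matrix of `A × (E₀ × E₀)` (glue between the aiming arithmetic and the carriers)

Layer `Literature/AlgebraicGeometry/Motives`, the ALGEBRAIC GLUE between the aiming arithmetic
(`Motives/WeilFormAimingArithmetic`, `aimingArithmetic`: over the abstract quadratic algebra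
`K = ℚ + ℚα`, a Weil–Hermitian space of signature `(n, n)` becomes hyperbolic after adding the
binary space `⟨m₁ r⟩ ⊥ ⟨-m₂ r⟩` for suitable positive integers `m₁, m₂`) and the carrier side
(`Motives/HyperbolicWeilTypeProduct`, `isHyperbolicWeilType_prod_of_rationalModels`: a hyperbolic
frame of `A × B` from `2N` independent rational coefficient vectors spanning a stable, totally
isotropic subspace for the block Gram matrix of the rational models). In COORDINATES (`ι_A → ℚ`
with the rational matrix `M_A` of `φ^*`, `M_A² = -d`, and the Gram matrix `G_A`; the partner
`E₀ × E₀` contributing two copies of `ℚ² = Fin 2 → ℚ` with `± M_E`, `G_E`):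

* `exists_quadraticField` — a field `K = ℚ(α)`, `α² = -d`, `K = ℚ + ℚ α` (`ℚ[X]/(X² + d)`);
* `exists_isotropic_blockVectors` — **given `(M_A, G_A)` of Weil type and signature `(n, n)`
  (`dim = 4n`), a binary partner `(M_E, G_E)` of Weil type with `G_E(e₀, M_E e₀) ≠ 0`, and non-zero
  weights `κ₁, κ₂`, there are positive integers `m₁, m₂` and `2n + 2` `ℚ`-independent vectors in
  `(ι_A ⊕ (Fin 2 ⊕ Fin 2)) → ℚ` spanning an `(M_A ⊕ M_E ⊕ -M_E)`-stable subspace totally isotropic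
  for `fromBlocks ((κ₁ m₁ m₂) • G_A) 0 0 (fromBlocks ((κ₂ m₂) • G_E) 0 0 ((κ₂ m₁) • G_E))`** — the
  shape of the Gram matrix of `A × (E₀ × E₀)` for the class `pr_A^* h_A + m₁ pr₁^* η + m₂ pr₂^* η`
  (`κ₁ = 2·C(2N-1, 2n-1)·d_E²`, `κ₂ = C(2N-1, 2n)·d_A`, up to the factor `d_E` in `G_E`).

Proof of the second: make `ι_A → ℚ` a `K`-vector space with `α = M_A` (`Motives/WeilOperatorModule`),
read the signature subspaces as `K`-subspaces, apply `aimingArithmetic` with `r₁ = r₂ = ρ = κ₂ r₀ / κ₁`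
(`r₀ = G_E(e₀, M_E e₀)`), and transport the Lagrangian `L ⊆ V × K²` along
`Θ(v, k₀, k₁) = (v, m₁(re k₀ · e₀ + im k₀ · M_E e₀), m₂(re k₁ · e₀ - im k₁ · M_E e₀))`, which is
`ℚ`-linear, injective, `α`-equivariant, and pulls the Gram matrix back to `κ₁ m₁ m₂ · (E_A ⊕ E_{(m₁ρ, -m₂ρ)})`.

Scope: the partner shape `(M_E, G_E; ± M_E)` is that of a CM Weil surface `E₀ × E₀` with `K` acting
through `(ι, ῑ)` and a weighted product class (Schoen, Compositio 114 (1998) §10; Markman,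
arXiv:2509.23403 §11.5 Step 2; van Geemen, LNM 1594, 5.3). Provenance: first landed on the summit
side (route `HeckePrymWeil` of the Hodge summit, file `Theorems/HeckePrymWeilAimedDescendingIsotropicGlue`,
same statements and proofs); re-hosted here because the facts that need it are Literature facts,
whose discharges cannot import `Summits` (CONVENTIONS §2). Everything is proved; no definition and
no named fact is introduced.

## References

* [vanGeemen1994HodgeAV] B. van Geemen, An introduction to the Hodge conjecture for abelian
  varieties, LNM 1594 (1994), Lemma 5.2 (2)–(4), 5.3, 5.4 (5.4.1).
* [Schoen1998HodgeWeilAddendum] C. Schoen, Compositio Math. 114 (1998), §10.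
* [Markman2025SurveySecant] E. Markman, arXiv:2509.23403, §11.5 Step 2.
-/

noncomputable section

open Module Polynomial

namespace Literature.AlgebraicGeometry.Motives

/-! ### The quadratic field `ℚ(√-d)` as an abstract `K = ℚ + ℚ α` -/

/-- **`K = ℚ[X]/(X² + d)` is a field with `α² = -d` and `K = ℚ + ℚ α`** (`d > 0`: `X² + d` has no
rational root, hence is irreducible). The shape `(K, α, hα, hK)` is the one consumed by
`aimingArithmetic` and `Motives/WeilDiscriminant*`. [folklore] -/
theorem exists_quadraticField (d : ℚ) (hd : 0 < d) :
    ∃ (K : Type) (_ : Field K) (_ : Algebra ℚ K) (α : K),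
      α * α = algebraMap ℚ K (-d) ∧ ∀ k : K, ∃ a b : ℚ, k = algebraMap ℚ K a + algebraMap ℚ K b * α := by
  set f : ℚ[X] := X ^ 2 + C d with hf
  have hmonic : f.Monic := by
    rw [hf]
    exact monic_X_pow_add_C d two_ne_zero
  have hdeg : f.natDegree = 2 := by
    rw [hf]
    exact natDegree_X_pow_add_C
  have hirr : Irreducible f := by
    rw [hmonic.irreducible_iff_roots_eq_zero_of_degree_le_three (by omega) (by omega),
      Multiset.eq_zero_iff_forall_notMem]
    intro x hx
    rw [mem_roots hmonic.ne_zero, IsRoot.def, hf, eval_add, eval_pow, eval_X, eval_C] at hx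
    nlinarith [sq_nonneg x]
  haveI : Fact (Irreducible f) := ⟨hirr⟩
  refine ⟨AdjoinRoot f, inferInstance, inferInstance, AdjoinRoot.root f, ?_, ?_⟩
  · have h0 : AdjoinRoot.mk f (X ^ 2 + C d) = 0 := by
      rw [← hf]
      exact AdjoinRoot.mk_self
    rw [map_add, map_pow, AdjoinRoot.mk_X, AdjoinRoot.mk_C] at h0
    rw [map_neg, show algebraMap ℚ (AdjoinRoot f) d = AdjoinRoot.of f d from rfl, ← sq]
    exact eq_neg_of_add_eq_zero_left h0
  · intro k
    let pb := AdjoinRoot.powerBasis' (R := ℚ) hmonic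
    have hdim : pb.dim = 2 := hdeg
    have hsum := pb.basis.sum_repr k
    refine ⟨pb.basis.repr k ⟨0, by rw [hdim]; norm_num⟩, pb.basis.repr k ⟨1, by rw [hdim]; norm_num⟩, ?_⟩
    conv_lhs => rw [← hsum]
    have huniv : (Finset.univ : Finset (Fin pb.dim)) =
        {⟨0, by rw [hdim]; norm_num⟩, ⟨1, by rw [hdim]; norm_num⟩} := by
      ext i
      simp only [Finset.mem_univ, Finset.mem_insert, Finset.mem_singleton, true_iff]
      rcases i with ⟨i, hi⟩
      rw [hdim] at hi
      rcases Nat.lt_succ_iff.1 hi |>.lt_or_eq with h | h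
      · left; exact Fin.ext (by simpa using h)
      · right; exact Fin.ext h
    rw [huniv, Finset.sum_pair (by simp [Fin.ext_iff]), pb.coe_basis]
    simp only [pow_zero, pow_one, Algebra.smul_def, mul_one]
    rfl

/-! ### The binary side: `(ℚ², ±M_E, G_E) ≅ (K, ±r₀)` -/

section Binary

variable {K : Type*} [Field K] [Algebra ℚ K] {α : K} {d : ℚ} (hd : 0 < d)
  (hα : α * α = algebraMap ℚ K (-d))
  (hK : ∀ k : K, ∃ a b : ℚ, k = algebraMap ℚ K a + algebraMap ℚ K b * α)
  (ME : Matrix (Fin 2) (Fin 2) ℚ) (GE : Matrix (Fin 2) (Fin 2) ℚ)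

/-- The transport `θ₊(k) = re k · v + im k · M_E v` of `K` onto `ℚ²` intertwines `α` with `M_E`:
`θ₊(α k) = M_E θ₊(k)` (`M_E² = -d`). [folklore] -/
theorem binaryTransport_alpha_mul (v : Fin 2 → ℚ) (hME : ∀ w, ME.mulVec (ME.mulVec w) = -(d • w))
    (k : K) :
    reCoord hd hα hK (α * k) • v + imCoord hd hα hK (α * k) • ME.mulVec v =
      ME.mulVec (reCoord hd hα hK k • v + imCoord hd hα hK k • ME.mulVec v) := by
  rw [reCoord_alpha_mul, imCoord_alpha_mul, Matrix.mulVec_add, Matrix.mulVec_smul,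
    Matrix.mulVec_smul, hME]
  ext i
  simp only [Pi.add_apply, Pi.smul_apply, Pi.neg_apply, smul_eq_mul]
  ring

/-- The conjugate transport `θ₋(k) = re k · v - im k · M_E v` intertwines `α` with `-M_E`:
`θ₋(α k) = -M_E θ₋(k)`. [folklore] -/
theorem binaryTransport_alpha_mul_neg (v : Fin 2 → ℚ) (hME : ∀ w, ME.mulVec (ME.mulVec w) = -(d • w))
    (k : K) :
    reCoord hd hα hK (α * k) • v - imCoord hd hα hK (α * k) • ME.mulVec v =
      -ME.mulVec (reCoord hd hα hK k • v - imCoord hd hα hK k • ME.mulVec v) := by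
  rw [reCoord_alpha_mul, imCoord_alpha_mul, Matrix.mulVec_sub, Matrix.mulVec_smul,
    Matrix.mulVec_smul, hME]
  ext i
  simp only [Pi.sub_apply, Pi.smul_apply, Pi.neg_apply, smul_eq_mul]
  ring

variable {ME GE}

/-- **The pairing in the transported coordinates**: for `G_E` alternating (on `ℚ²` an alternating
form is determined by one value, so no Weil-type hypothesis is needed),
`G_E(θ₊ k, θ₊ k') = r₀ (re k · im k' - im k · re k')` with `r₀ = G_E(v, M_E v)` — the binary Weil
form of weight `r₀` (van Geemen 5.3: the `H₁` of `E₀`).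
[cite: vanGeemen1994HodgeAV, 5.3] -/
theorem dotProduct_binaryTransport (hGEt : ∀ x y : Fin 2 → ℚ, y ⬝ᵥ GE.mulVec x = -(x ⬝ᵥ GE.mulVec y))
    (v : Fin 2 → ℚ) (k k' : K) :
    (reCoord hd hα hK k • v + imCoord hd hα hK k • ME.mulVec v) ⬝ᵥ
        GE.mulVec (reCoord hd hα hK k' • v + imCoord hd hα hK k' • ME.mulVec v) =
      (v ⬝ᵥ GE.mulVec (ME.mulVec v)) *
        (reCoord hd hα hK k * imCoord hd hα hK k' - imCoord hd hα hK k * reCoord hd hα hK k') := by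
  have h0 : ∀ x : Fin 2 → ℚ, x ⬝ᵥ GE.mulVec x = 0 := fun x => by
    have h := hGEt x x
    linarith
  have h1 : ME.mulVec v ⬝ᵥ GE.mulVec v = -(v ⬝ᵥ GE.mulVec (ME.mulVec v)) := hGEt _ _
  simp only [Matrix.mulVec_add, Matrix.mulVec_smul, dotProduct_add, add_dotProduct, dotProduct_smul,
    smul_dotProduct, smul_eq_mul, h0, h1]
  ring

/-- The conjugate case: `G_E(θ₋ k, θ₋ k') = -r₀ (re k · im k' - im k · re k')`. [cite: vanGeemen1994HodgeAV, 5.3] -/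
theorem dotProduct_binaryTransport_neg
    (hGEt : ∀ x y : Fin 2 → ℚ, y ⬝ᵥ GE.mulVec x = -(x ⬝ᵥ GE.mulVec y))
    (v : Fin 2 → ℚ) (k k' : K) :
    (reCoord hd hα hK k • v - imCoord hd hα hK k • ME.mulVec v) ⬝ᵥ
        GE.mulVec (reCoord hd hα hK k' • v - imCoord hd hα hK k' • ME.mulVec v) =
      -(v ⬝ᵥ GE.mulVec (ME.mulVec v)) *
        (reCoord hd hα hK k * imCoord hd hα hK k' - imCoord hd hα hK k * reCoord hd hα hK k') := by
  have h0 : ∀ x : Fin 2 → ℚ, x ⬝ᵥ GE.mulVec x = 0 := fun x => by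
    have h := hGEt x x
    linarith
  have h1 : ME.mulVec v ⬝ᵥ GE.mulVec v = -(v ⬝ᵥ GE.mulVec (ME.mulVec v)) := hGEt _ _
  simp only [Matrix.mulVec_sub, Matrix.mulVec_smul, dotProduct_sub, sub_dotProduct, dotProduct_smul,
    smul_dotProduct, smul_eq_mul, h0, h1]
  ring

/-- **`r₀ = G_E(e₀, M_E e₀) ≠ 0` makes `θ₊` injective**: if `re k · v + im k · M_E v = 0` with
`v ⬝ G_E (M_E v) ≠ 0` then `k = 0`. [folklore] -/
theorem eq_zero_of_binaryTransport_eq_zero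
    (hGEt : ∀ x y : Fin 2 → ℚ, y ⬝ᵥ GE.mulVec x = -(x ⬝ᵥ GE.mulVec y))
    {v : Fin 2 → ℚ} (hv : v ⬝ᵥ GE.mulVec (ME.mulVec v) ≠ 0) (ε : ℚ) (hε : ε ≠ 0) {k : K}
    (hk : reCoord hd hα hK k • v + (ε * imCoord hd hα hK k) • ME.mulVec v = 0) : k = 0 := by
  have h0 : ∀ x : Fin 2 → ℚ, x ⬝ᵥ GE.mulVec x = 0 := fun x => by
    have h := hGEt x x
    linarith
  -- pair with `G_E v` and with `G_E (M_E v)`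
  have e1 := congrArg (fun w => w ⬝ᵥ GE.mulVec v) hk
  have e2 := congrArg (fun w => w ⬝ᵥ GE.mulVec (ME.mulVec v)) hk
  simp only [add_dotProduct, smul_dotProduct, smul_eq_mul, zero_dotProduct, h0, hGEt v (ME.mulVec v),
    mul_zero, zero_add, add_zero, mul_neg, neg_eq_zero, mul_eq_zero, hε, hv, or_false, false_or] at e1 e2
  rw [eq_reCoord_add_imCoord hd hα hK k, e1, e2]
  simp

end Binary

/-! ### The glue: isotropic vectors for the block Gram matrix -/

/-- `Sum.elim a b ⬝ Sum.elim c e = a ⬝ c + b ⬝ e`. [folklore] -/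
theorem sumElim_dotProduct_sumElim {ι₁ ι₂ : Type} [Fintype ι₁] [Fintype ι₂] (a c : ι₁ → ℚ)
    (b e : ι₂ → ℚ) : Sum.elim a b ⬝ᵥ Sum.elim c e = a ⬝ᵥ c + b ⬝ᵥ e := by
  simp only [dotProduct, Fintype.sum_sum_type, Sum.elim_inl, Sum.elim_inr]
/-- **Isotropic vectors for the block Gram matrix of `A × (E₀ × E₀)`** — the algebraic glue between
`aimingArithmetic` (file III) and `isHyperbolicWeilType_prod_of_rationalModels` (file VI). Data, in
coordinates over `ℚ`: the rational matrix `M_A` of `φ^*` on `H¹(A)` (`M_A² = -d`) and the Gram matrix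
`G_A` of the polarization pairing (alternating, of Weil type `G_A(M_A x, M_A y) = d G_A(x, y)`), of
SIGNATURE `(n, n)` (`dim = 4n`; `M_A`-stable `ℚ`-subspaces `P`, `N` of dimension `2n` with
`P ⊓ N = 0` on which `x ↦ G_A(x, M_A x)` is positive, resp. negative); the binary partner `(M_E, G_E)`
(`M_E² = -d`, `G_E` alternating) with `r₀ = G_E(v₀, M_E v₀) ≠ 0`; non-zero weights `κ₁, κ₂`. THEN
there are positive integers `m₁, m₂` and `2(n+1)` `ℚ`-independent vectors of
`(ι_A ⊕ (Fin 2 ⊕ Fin 2)) → ℚ` spanning an `(M_A ⊕ M_E ⊕ -M_E)`-stable subspace, totally isotropic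
for `fromBlocks ((κ₁ m₁ m₂)·G_A) 0 0 (fromBlocks ((κ₂ m₂)·G_E) 0 0 ((κ₂ m₁)·G_E))` (Landherr's lever
`δ² = 1`: Schoen 1998 §10; Markman arXiv:2509.23403 §11.5 Step 2; van Geemen 1994, 5.2–5.4).
Proof: module docstring. [cite: vanGeemen1994HodgeAV, Lemma 5.2 (3), 5.3 and 5.4 (5.4.1)] -/
theorem exists_isotropic_blockVectors {d : ℚ} (hd : 0 < d) {ιA : Type} [Fintype ιA] [DecidableEq ιA]
    (MA : Matrix ιA ιA ℚ) (hMA : ∀ v, MA.mulVec (MA.mulVec v) = -(d • v))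
    (GA : Matrix ιA ιA ℚ) (hGAt : ∀ x y : ιA → ℚ, y ⬝ᵥ GA.mulVec x = -(x ⬝ᵥ GA.mulVec y))
    (hWA : ∀ x y : ιA → ℚ, MA.mulVec x ⬝ᵥ GA.mulVec (MA.mulVec y) = d * (x ⬝ᵥ GA.mulVec y))
    (n : ℕ) (hcard : Fintype.card ιA = 4 * n)
    (hPN : ∃ P N : Submodule ℚ (ιA → ℚ), (∀ v ∈ P, MA.mulVec v ∈ P) ∧ (∀ v ∈ N, MA.mulVec v ∈ N) ∧
      Module.finrank ℚ P = 2 * n ∧ Module.finrank ℚ N = 2 * n ∧ P ⊓ N = ⊥ ∧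
      (∀ x ∈ P, x ≠ 0 → 0 < x ⬝ᵥ GA.mulVec (MA.mulVec x)) ∧
      (∀ x ∈ N, x ≠ 0 → x ⬝ᵥ GA.mulVec (MA.mulVec x) < 0))
    (ME : Matrix (Fin 2) (Fin 2) ℚ) (hME : ∀ v, ME.mulVec (ME.mulVec v) = -(d • v))
    (GE : Matrix (Fin 2) (Fin 2) ℚ) (hGEt : ∀ x y : Fin 2 → ℚ, y ⬝ᵥ GE.mulVec x = -(x ⬝ᵥ GE.mulVec y))
    (v₀ : Fin 2 → ℚ) (hr₀ : v₀ ⬝ᵥ GE.mulVec (ME.mulVec v₀) ≠ 0)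
    (κ₁ κ₂ : ℚ) (hκ₁ : κ₁ ≠ 0) (hκ₂ : κ₂ ≠ 0) :
    ∃ m₁ m₂ : ℕ, 0 < m₁ ∧ 0 < m₂ ∧
      ∃ b : Fin (2 * (n + 1)) → (ιA ⊕ (Fin 2 ⊕ Fin 2)) → ℚ, LinearIndependent ℚ b ∧
        (∀ k, ∃ c : Fin (2 * (n + 1)) → ℚ,
          (Matrix.fromBlocks MA 0 0 (Matrix.fromBlocks ME 0 0 (-ME))).mulVec (b k) = ∑ l, c l • b l) ∧
        (∀ k l, ∑ s, ∑ t, b k s *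
          (Matrix.fromBlocks ((κ₁ * m₁ * m₂) • GA) 0 0
            (Matrix.fromBlocks ((κ₂ * m₂) • GE) 0 0 ((κ₂ * m₁) • GE))) s t * b l t = 0) := by
  classical
  -- the quadratic algebra `K = ℚ + ℚ α`, `α² = -d`
  obtain ⟨K, _, _, α, hα, hK⟩ := exists_quadraticField d hd
  -- `V = ι_A → ℚ` as a `K`-vector space with `α = M_A`
  haveI : Module.Finite ℚ K := Module.Finite.of_basis (basisOneAlpha hd hα hK)
  obtain ⟨inst, hinst⟩ := exists_module_smul_eq (V := ιA → ℚ) hd hα hK (Matrix.mulVecLin MA)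
    (fun v => by rw [Matrix.mulVecLin_apply, Matrix.mulVecLin_apply]; exact hMA v)
  letI : Module K (ιA → ℚ) := inst
  haveI : IsScalarTower ℚ K (ιA → ℚ) := hinst.1
  have hαM : ∀ v : ιA → ℚ, α • v = MA.mulVec v := fun v => by rw [hinst.2 v, Matrix.mulVecLin_apply]
  haveI : Module.Finite K (ιA → ℚ) := Module.Finite.of_restrictScalars_finite ℚ K (ιA → ℚ)
  have hV : Module.finrank K (ιA → ℚ) = 2 * n := by
    have h := two_mul_finrank_eq_of_weilOperator (V := ιA → ℚ) hd hα hK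
    rw [Module.finrank_fintype_fun_eq_card, hcard] at h
    omega
  -- the Weil form `E = G_A`
  set E : LinearMap.BilinForm ℚ (ιA → ℚ) := Matrix.toBilin' GA with hEdef
  have hEapp : ∀ x y : ιA → ℚ, E x y = x ⬝ᵥ GA.mulVec y := fun x y => Matrix.toBilin'_apply' GA x y
  have hE : ∀ x y : ιA → ℚ, E x y = -E y x := fun x y => by rw [hEapp, hEapp, hGAt]
  have hW : ∀ x y : ιA → ℚ, E (α • x) (α • y) = d * E x y := fun x y => by rw [hEapp, hEapp, hαM, hαM, hWA]
  -- signature `(n, n)` read over `K`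
  have hPN' : ∃ P N : Submodule K (ιA → ℚ), Module.finrank K P = n ∧ Module.finrank K N = n ∧ P ⊓ N = ⊥ ∧
      (∀ x ∈ P, x ≠ 0 → 0 < E x (α • x)) ∧ (∀ x ∈ N, x ≠ 0 → E x (α • x) < 0) := by
    obtain ⟨P, N, hP, hN, hPf, hNf, hPN0, hpos, hneg⟩ := hPN
    obtain ⟨P', hP'⟩ := exists_restrictScalars_eq_of_stable hd hα hK (Matrix.mulVecLin MA)
      hinst.2 P (fun v hv => by simpa using hP v hv)
    obtain ⟨N', hN'⟩ := exists_restrictScalars_eq_of_stable hd hα hK (Matrix.mulVecLin MA)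
      hinst.2 N (fun v hv => by simpa using hN v hv)
    refine ⟨P', N', ?_, ?_, inf_eq_bot_of_restrictScalars (by rw [hP', hN', hPN0]), ?_, ?_⟩
    · have h := two_mul_finrank_submodule_eq (V := ιA → ℚ) hd hα hK P'
      rw [hP', hPf] at h
      omega
    · have h := two_mul_finrank_submodule_eq (V := ιA → ℚ) hd hα hK N'
      rw [hN', hNf] at h
      omega
    · intro x hx hx0
      have hx' : x ∈ P := by rw [← hP']; exact hx
      rw [hEapp, hαM]
      exact hpos x hx' hx0
    · intro x hx hx0
      have hx' : x ∈ N := by rw [← hN']; exact hx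
      rw [hEapp, hαM]
      exact hneg x hx' hx0
  -- the aiming arithmetic, with `r₁ = r₂ = ρ = κ₂ r₀ / κ₁`
  set r₀ : ℚ := v₀ ⬝ᵥ GE.mulVec (ME.mulVec v₀) with hr₀def
  set ρ : ℚ := κ₂ * r₀ / κ₁ with hρ
  have hρ0 : ρ ≠ 0 := div_ne_zero (mul_ne_zero hκ₂ hr₀) hκ₁
  obtain ⟨m₁, m₂, hm₁, hm₂, L, hL, hiso⟩ :=
    aimingArithmetic hd hα hK (ιA → ℚ) n hV E hE hW hPN' ρ ρ (mul_self_pos.2 hρ0)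
  refine ⟨m₁, m₂, hm₁, hm₂, ?_⟩
  -- the transport `Θ : V × K² → (ι_A ⊕ (Fin 2 ⊕ Fin 2)) → ℚ`
  let θ₁ : K → Fin 2 → ℚ := fun k =>
    (m₁ : ℚ) • (reCoord hd hα hK k • v₀ + imCoord hd hα hK k • ME.mulVec v₀)
  let θ₂ : K → Fin 2 → ℚ := fun k =>
    (m₂ : ℚ) • (reCoord hd hα hK k • v₀ - imCoord hd hα hK k • ME.mulVec v₀)
  have hθ₁ : ∀ k, θ₁ k = (m₁ : ℚ) • (reCoord hd hα hK k • v₀ + imCoord hd hα hK k • ME.mulVec v₀) :=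
    fun _ => rfl
  have hθ₂ : ∀ k, θ₂ k = (m₂ : ℚ) • (reCoord hd hα hK k • v₀ - imCoord hd hα hK k • ME.mulVec v₀) :=
    fun _ => rfl
  let Θ : ((ιA → ℚ) × (Fin 2 → K)) →ₗ[ℚ] (ιA ⊕ (Fin 2 ⊕ Fin 2) → ℚ) :=
    { toFun := fun y => Sum.elim y.1 (Sum.elim (θ₁ (y.2 0)) (θ₂ (y.2 1)))
      map_add' := fun y y' => by
        funext s
        rcases s with i | (j | j)
        · rfl
        · simp only [Prod.snd_add, Pi.add_apply, Sum.elim_inr, Sum.elim_inl, hθ₁, map_add]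
          simp only [Pi.smul_apply, Pi.add_apply, smul_eq_mul]
          ring
        · simp only [Prod.snd_add, Pi.add_apply, Sum.elim_inr, hθ₂, map_add]
          simp only [Pi.smul_apply, Pi.sub_apply, smul_eq_mul]
          ring
      map_smul' := fun q y => by
        funext s
        rcases s with i | (j | j)
        · rfl
        · simp only [Prod.smul_snd, Pi.smul_apply, Sum.elim_inr, Sum.elim_inl, hθ₁, map_smul,
            RingHom.id_apply, smul_eq_mul, Pi.add_apply]
          ring
        · simp only [Prod.smul_snd, Pi.smul_apply, Sum.elim_inr, hθ₂, map_smul, RingHom.id_apply,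
            smul_eq_mul, Pi.sub_apply]
          ring }
  have hΘ : ∀ y, Θ y = Sum.elim y.1 (Sum.elim (θ₁ (y.2 0)) (θ₂ (y.2 1))) := fun _ => rfl
  -- `Θ` is injective
  have hΘinj : Function.Injective Θ := by
    rw [← LinearMap.ker_eq_bot, LinearMap.ker_eq_bot']
    intro y hy
    rw [hΘ] at hy
    have h1 : y.1 = 0 := by
      funext i
      exact congrFun hy (Sum.inl i)
    have h20 : θ₁ (y.2 0) = 0 := by
      funext j
      exact congrFun hy (Sum.inr (Sum.inl j))
    have h21 : θ₂ (y.2 1) = 0 := by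
      funext j
      exact congrFun hy (Sum.inr (Sum.inr j))
    have hm₁0 : (m₁ : ℚ) ≠ 0 := Nat.cast_ne_zero.2 hm₁.ne'
    have hm₂0 : (m₂ : ℚ) ≠ 0 := Nat.cast_ne_zero.2 hm₂.ne'
    rw [hθ₁, smul_eq_zero, or_iff_right hm₁0] at h20
    rw [hθ₂, smul_eq_zero, or_iff_right hm₂0, sub_eq_add_neg, ← neg_smul, neg_eq_neg_one_mul] at h21
    have k0 : y.2 0 = 0 :=
      eq_zero_of_binaryTransport_eq_zero hd hα hK hGEt hr₀ 1 one_ne_zero (by rwa [one_mul])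
    have k1 : y.2 1 = 0 :=
      eq_zero_of_binaryTransport_eq_zero hd hα hK hGEt hr₀ (-1) (by norm_num) h21
    refine Prod.ext h1 (funext fun j => ?_)
    fin_cases j
    · exact k0
    · exact k1
  -- `Θ` intertwines `α` with `M_A ⊕ M_E ⊕ (-M_E)`
  have hΘα : ∀ y : (ιA → ℚ) × (Fin 2 → K),
      (Matrix.fromBlocks MA 0 0 (Matrix.fromBlocks ME 0 0 (-ME))).mulVec (Θ y) = Θ (α • y) := by
    intro y
    rw [hΘ, hΘ, Matrix.fromBlocks_mulVec, Matrix.fromBlocks_mulVec]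
    simp only [Matrix.zero_mulVec, add_zero, zero_add, Prod.smul_fst, Prod.smul_snd, Pi.smul_apply,
      smul_eq_mul, hαM]
    congr 1
    · funext s
      rcases s with j | j
      · simp only [Sum.elim_inl, Function.comp_def, Sum.elim_inr]
        rw [hθ₁, hθ₁, Matrix.mulVec_smul, binaryTransport_alpha_mul hd hα hK ME v₀ hME]
      · simp only [Sum.elim_inr, Function.comp_def]
        rw [hθ₂, hθ₂, Matrix.mulVec_smul, Matrix.neg_mulVec,
          binaryTransport_alpha_mul_neg hd hα hK ME v₀ hME]
  -- `Θ` pulls the block Gram matrix back to `κ₁ m₁ m₂ · (E ⊕ E_{(m₁ρ, -m₂ρ)})`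
  have hΘG : ∀ y y' : (ιA → ℚ) × (Fin 2 → K),
      Θ y ⬝ᵥ (Matrix.fromBlocks ((κ₁ * m₁ * m₂) • GA) 0 0
          (Matrix.fromBlocks ((κ₂ * m₂) • GE) 0 0 ((κ₂ * m₁) • GE))).mulVec (Θ y') =
        (κ₁ * m₁ * m₂) * bilinOrthSum E (diagWeilForm hd hα hK (Pi.basisFun K (Fin 2))
          ![(m₁ : ℚ) * ρ, -((m₂ : ℚ) * ρ)]) y y' := by
    intro y y'
    rw [hΘ, hΘ, Matrix.fromBlocks_mulVec, Matrix.fromBlocks_mulVec, sumElim_dotProduct_sumElim]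
    simp only [Matrix.zero_mulVec, add_zero, zero_add, Function.comp_def, Sum.elim_inl, Sum.elim_inr]
    rw [show (fun x => θ₁ (y'.2 0) x) = θ₁ (y'.2 0) from rfl,
      show (fun x => θ₂ (y'.2 1) x) = θ₂ (y'.2 1) from rfl, show (fun x => y'.1 x) = y'.1 from rfl,
      sumElim_dotProduct_sumElim]
    simp only [Matrix.smul_mulVec, dotProduct_smul, smul_eq_mul, hθ₁, hθ₂, Matrix.mulVec_smul,
      smul_dotProduct, dotProduct_binaryTransport hd hα hK hGEt v₀,
      dotProduct_binaryTransport_neg hd hα hK hGEt v₀]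
    rw [bilinOrthSum_apply, diagWeilForm_apply, Fin.sum_univ_two, hEapp]
    simp only [Module.Basis.coord_apply, Pi.basisFun_repr, Matrix.cons_val_zero, Matrix.cons_val_one]
    rw [← hr₀def, hρ]
    field_simp
  -- a `ℚ`-basis of `L`
  haveI : Module.Finite ℚ (L.restrictScalars ℚ) := Module.Finite.of_injective
    (L.restrictScalars ℚ).subtype Subtype.val_injective
  have hLℚ : Module.finrank ℚ (L.restrictScalars ℚ) = 2 * (n + 1) := by
    have h := two_mul_finrank_submodule_eq (V := (ιA → ℚ) × (Fin 2 → K)) hd hα hK L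
    rw [hL] at h
    omega
  let bL := Module.finBasisOfFinrankEq ℚ (L.restrictScalars ℚ) hLℚ
  refine ⟨fun k => Θ (bL k : (ιA → ℚ) × (Fin 2 → K)), ?_, ?_, ?_⟩
  · -- independence
    have h := bL.linearIndependent.map' (Θ ∘ₗ (L.restrictScalars ℚ).subtype)
      (LinearMap.ker_eq_bot.2 (hΘinj.comp Subtype.val_injective))
    exact h
  · -- stability
    intro k
    have hmem : α • (bL k : (ιA → ℚ) × (Fin 2 → K)) ∈ L.restrictScalars ℚ := L.smul_mem α (bL k).2
    refine ⟨fun l => bL.repr ⟨_, hmem⟩ l, ?_⟩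
    rw [hΘα]
    have hsum := bL.sum_repr ⟨_, hmem⟩
    have h := congrArg (fun z : L.restrictScalars ℚ => Θ (z : (ιA → ℚ) × (Fin 2 → K))) hsum
    simp only at h
    rw [← h]
    simp only [Submodule.coe_sum, Submodule.coe_smul_of_tower, map_sum, map_smul]
  · -- isotropy
    intro k l
    have hk : ((bL k : L.restrictScalars ℚ) : (ιA → ℚ) × (Fin 2 → K)) ∈ L := (bL k).2
    have hl : ((bL l : L.restrictScalars ℚ) : (ιA → ℚ) × (Fin 2 → K)) ∈ L := (bL l).2
    have h := hΘG (bL k) (bL l)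
    rw [hiso _ hk _ hl, mul_zero] at h
    rw [← h]
    simp only [dotProduct, Matrix.mulVec, Finset.mul_sum]
    refine Finset.sum_congr rfl fun s _ => Finset.sum_congr rfl fun t _ => ?_
    ring

end Literature.AlgebraicGeometry.Motives

end
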